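import Mathlib
import HarnessLib
import Literature.MathematicalPhysics.QuantumLattice.KohnLuttingerChannelStates
import Summits.HubbardSuperconductivity.HubbardSuperconductivity.Theorems.WeakCouplingBCSWcbcsKohnLuttingerB1gFormAWindowD005D035
import Summits.HubbardSuperconductivity.HubbardSuperconductivity.Theorems.WeakCouplingBCSWcbcsKohnLuttingerB1gFormAWindowD010D025
import Summits.HubbardSuperconductivity.HubbardSuperconductivity.Theorems.ChiralWindowCwThesisChannelInfNonpos
import Summits.HubbardSuperconductivity.HubbardSuperconductivity.Theorems.ChiralWindowCwKLChiralWindowD4Invariant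

/-!
# Route `WeakCouplingBCS` — support item `WcbcsKohnLuttingerB1g` (stmt-HubbardSuperconductivity-0158):
# the SUBLATTICE DUALITY of the `O(U²)` Kohn–Luttinger channel problem (`t'`-only band = `t`-only band of a sublattice,
# `d_{x²-y²} ↔ d_{xy}`) and the certified NEGATIVE `B1g` window it yields for free

Cell gate-hubbard-kl, KL-MARGIN-SCAN reader hubbard-klscan-idea-3 (lens «dual»), crux idea `sublattice-duality`, graded
new-combination / keep with statement audit «no defect» by hubbard-klscan-crit-1 (GRADES-crit1-r2.md §R3-2).

The pure next-nearest-neighbour band `ε' = squareDispersion 0 t'` is EXACTLY the nearest-neighbour band `ε = squareDispersion t' 0` composed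
with the linear sublattice map `A k = (k₀ + k₁, k₀ - k₁)` (`KlSublattice.squareDispersion_nnn_eq`; `A = √2 ·` orthogonal, `|det A| = 2`,
`k ↦ A k (mod 2π)` a 2:1 covering of the Brillouin torus with deck shift `(π, π)`).  `A` intertwines the point group up to the OUTER
automorphism of `D₄` (`A ∘ r = r³ ∘ A`, `A ∘ s = s r³ ∘ A`: `sublatticeMap_rot`, `sublatticeMap_refl`), which swaps `B1g ↔ B2g` and fixes
`A1g, A2g, E` (`tauIrrep`, `d4Project_tau`, `inChannel_tau`, PROVED).  This file

* states the items of the line (NOT proved here, all exact identities / transports, tagged [folklore]):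
  S0 `SublatticeFormBddBelow` (land first), K1 `ChannelInfSublatticeLe` (pull-back along the cover), K2 `ChannelInfSublatticeGe`
  (deck-averaging, `min … 0` form), S1 `LindhardSublattice` (`χ₀' = χ₀ ∘ A`), S2 `FillingSublattice` (`n' = n`), S3 `ChannelInfNNNSign`
  (sign of `t'` immaterial on `μ ∈ (-4, 0)`);
* PROVES the glue: `channelInf_sublattice_eq` (K1 + K2 + the landed `CwThesis.stub_channelInfNonpos` ⇒
  `channelInf ε' μ U (τχ) = channelInf ε μ U χ`), `dualWindow_of`, `dualWindowB2g_d005_d035` (the LANDED positive window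
  `klb1g_window_d005_d035_const`, `γ = 10371/2^20` on `μ ∈ [-0.8925, -0.075]`, `U ∈ (0,1)`, modulo its twelve named enclosure hypotheses,
  read through the duality: for `ε' = squareDispersion 0 1` the channel `B2g = d_xy` leads and `B1g` TRAILS by `≥ γ U²` — a certified NEGATIVE
  `B1g` margin), `dualWindowB2g_negSign_of` (S3), `mu_d0125_mem_window` (unconditional, from `muOfDoping_mem_window_d010_d025`),
  `ratioAxisBracket_of`, `ratioAxisBracket_d0125_of_records : K1 → K2 → S2 → ⟨12 enclosure hyps⟩ → RatioAxisBracketD0125 (10371/1048576)` —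
  two certified cells of opposite `B1g`-margin sign at doping `δ = 1/8` exactly, at the two ends `t' = 0` and `t = 0` of the hopping-ratio axis
  (KL-MARGIN-SCAN HQ1 (iii), second format; and every certified `t' = 0` cell doubles as a certified `t = 0` cell with `B1g ↔ B2g`, HQ1 (i)).

HONEST FRAMING.  The far cell is the decoupled-sublattice limit `t = 0` — physically a relabelling of the landed theorem, far outside the
scan range `t'/t ∈ [-0.3, 0]`; given both cells it certifies only that the sign of the `δ = 1/8` `B1g` margin changes somewhere on
`t'/t ∈ (-∞, 0)`, not where, not that it changes once, not monotonicity (channel bottoms may jump at Lifshitz points).  Everything is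
conditional on the items above and on the same twelve enclosure hypotheses as the positive window.  No `instance`, no `notation`, no
record, no kit.  A Kohn–Luttinger `O(U²)` channel statement is not ODLRO and proves nothing about superconductivity in the Hubbard model.
-/

noncomputable section

set_option linter.dupNamespace false

namespace Summit.HubbardSuperconductivity.HubbardSuperconductivity.Theorems

open Literature.MathematicalPhysics.QuantumLattice
open Summit.HubbardSuperconductivity.HubbardSuperconductivity.Theorems.CwKLChiralWindow

namespace KlSublattice

/-! ### The sublattice map and the dispersion identity -/

/-- The sublattice (checkerboard) map `A k = (k₀ + k₁, k₀ - k₁)`: momenta of the square lattice ↦ momenta of one of its two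
next-nearest-neighbour sublattices (a square lattice rotated by 45°, lattice constant `√2`). [folklore] -/
def sublatticeMap (k : Momentum) : Momentum := WithLp.toLp 2 ![k 0 + k 1, k 0 - k 1]

/-- `(A k)₀ = k₀ + k₁`. [folklore] -/
@[simp] theorem sublatticeMap_apply_zero (k : Momentum) : sublatticeMap k 0 = k 0 + k 1 := by simp [sublatticeMap]
/-- `(A k)₁ = k₀ − k₁`. [folklore] -/
@[simp] theorem sublatticeMap_apply_one (k : Momentum) : sublatticeMap k 1 = k 0 - k 1 := by simp [sublatticeMap]

/-- `A` is additive (it is linear). [folklore] -/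
theorem sublatticeMap_add (k k' : Momentum) : sublatticeMap (k + k') = sublatticeMap k + sublatticeMap k' := by
  ext i; fin_cases i <;> simp <;> ring

/-- **The pure `t'` band is the pure `t` band of the sublattice**: `-4 t' cos k₀ cos k₁ = -2 t' (cos (k₀+k₁) + cos (k₀-k₁))`,
i.e. `squareDispersion 0 t' = squareDispersion t' 0 ∘ A`. [folklore] -/
theorem squareDispersion_nnn_eq (t' : ℝ) (k : Momentum) :
    squareDispersion 0 t' k = squareDispersion t' 0 (sublatticeMap k) := by
  simp only [squareDispersion, sublatticeMap_apply_zero, sublatticeMap_apply_one, Real.cos_add, Real.cos_sub]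
  ring

/-- The normalised case used below: `squareDispersion 0 1 = squareDispersion 1 0 ∘ sublatticeMap`. [folklore] -/
theorem squareDispersion_zero_one_eq : squareDispersion 0 1 = squareDispersion 1 0 ∘ sublatticeMap := by
  funext k; exact squareDispersion_nnn_eq 1 k

/-- The sign of `t'` is a particle–hole relabelling: `squareDispersion 0 (-1) = - squareDispersion 0 1`. [folklore] -/
theorem squareDispersion_zero_neg_one (k : Momentum) : squareDispersion 0 (-1) k = -squareDispersion 0 1 k := by
  simp only [squareDispersion]; ring

/-! ### `A` intertwines `D₄` up to its outer automorphism -/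


/-- `A ∘ r = r³ ∘ A`. [folklore] -/
@[simp] theorem sublatticeMap_rot (k : Momentum) :
    sublatticeMap (rotMomentum k) = rotMomentum (rotMomentum (rotMomentum (sublatticeMap k))) := by
  ext i; fin_cases i <;> simp <;> ring

/-- `A ∘ s = s r³ ∘ A`. [folklore] -/
@[simp] theorem sublatticeMap_refl (k : Momentum) :
    sublatticeMap (reflMomentum k) = reflMomentum (rotMomentum (rotMomentum (rotMomentum (sublatticeMap k)))) := by
  ext i; fin_cases i <;> (simp; try ring)

/-- The outer automorphism of `D₄` read on its irreducible characters: `B1g ↔ B2g`, the others fixed (an involution). [folklore] -/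
def tauIrrep : D4Irrep → D4Irrep
  | .B1g => .B2g
  | .B2g => .B1g
  | .A1g => .A1g
  | .A2g => .A2g
  | .E => .E

/-- `τ` is an involution on the irreducible characters. [folklore] -/
@[simp] theorem tauIrrep_tauIrrep (χ : D4Irrep) : tauIrrep (tauIrrep χ) = χ := by cases χ <;> rfl

/-- `τχ ≠ B1g` unless `χ = B2g`. [folklore] -/
theorem tauIrrep_ne_B1g {χ : D4Irrep} (h : χ ≠ D4Irrep.B2g) : tauIrrep χ ≠ D4Irrep.B1g := by
  cases χ <;> first | decide | exact absurd rfl h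

/-- **Intertwining of the isotypic projections**: `P_{τχ} (ψ ∘ A) = (P_χ ψ) ∘ A`. The eight terms match under
`r_i ↦ r_{-i}`, `s r_i ↦ s r_{3-i}`, along which `χ ↦ χ ∘ (·)` is `tauIrrep`. [folklore] -/
theorem d4Project_tau (χ : D4Irrep) (ψ : Momentum → ℝ) (k : Momentum) :
    d4Project (tauIrrep χ) (ψ ∘ sublatticeMap) k = d4Project χ ψ (sublatticeMap k) := by
  have ne10 : (1 : ZMod 4) ≠ 0 := by decide
  have ne12 : (1 : ZMod 4) ≠ 2 := by decide
  have ne20 : (2 : ZMod 4) ≠ 0 := by decide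
  have ne30 : (3 : ZMod 4) ≠ 0 := by decide
  have ne32 : (3 : ZMod 4) ≠ 2 := by decide
  cases χ <;>
  · simp only [d4Project, tauIrrep, sum_dihedralGroup_four, d4Momentum_r_zero, d4Momentum_r_one, d4Momentum_r_two,
      d4Momentum_r_three, d4Momentum_sr_zero, d4Momentum_sr_one, d4Momentum_sr_two, d4Momentum_sr_three,
      D4Irrep.char, D4Irrep.dim, zmod_four_val.1, zmod_four_val.2.1, zmod_four_val.2.2.1, zmod_four_val.2.2.2,
      Function.comp_apply, sublatticeMap_rot, sublatticeMap_refl, kl_d4_rot_rot_rot_rot, ne10, ne12, ne20, ne30, ne32,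
      if_true, if_false]
    norm_num
    try ring

/-- **`A` transports channels along `tauIrrep`**: `ψ ∈ χ ⇒ ψ ∘ A ∈ τχ` (so `d_{x²-y²}` gap functions of the sublattice band are
`d_{xy}` gap functions of the original lattice and conversely). [folklore] -/
theorem inChannel_tau {χ : D4Irrep} {ψ : Momentum → ℝ} (h : InChannel χ ψ) :
    InChannel (tauIrrep χ) (ψ ∘ sublatticeMap) := by
  unfold InChannel at h ⊢
  funext k
  rw [d4Project_tau]
  exact congrFun h (sublatticeMap k)

/-! ### The statements (cruxes K1, K2; supports S1–S3) — NOT proved here -/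

/-- **support S0 — the small-band value set is bounded below** (to be landed FIRST, hubbard-klscan-crit-1's audit §R3-2: without it
the `sInf` in `channelInf (squareDispersion 0 1) …` could be the junk `0` and K1 would be false in the window).  Schur / Hilbert–Schmidt
bound exactly as `klb1g_bddBelow`, with the kernel transported by `LindhardSublattice` and the finite Fermi-curve measure of the two
pockets. (the card's own OPEN statement, a hypothesis of the glue below — no cite tag) -/
def SublatticeFormBddBelow : Prop :=
  ∀ μ ∈ Set.Ioo (-4 : ℝ) 0, ∀ U : ℝ, ∀ χ : D4Irrep,
    BddBelow ((pairingForm (squareDispersion 0 1) μ U) '' {ψ | IsChannelState (squareDispersion 0 1) μ χ ψ})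

/-- **crux K1 (rank 2) — pull-back half of the sublattice duality.** For `μ ∈ (-4, 0)` every channel bottom of the pure-`t'`
band in the relabelled channel is at most the corresponding bottom of the pure-`t` band: a normalised `χ`-state `ψ` of
`ε = squareDispersion 1 0` pulls back to the (periodised) `τχ`-state `ψ ∘ A` of `ε' = squareDispersion 0 1` with the same value of
the pairing form (`K'(k,k') = K(Ak, Ak')` by `LindhardSublattice`; the Fermi-curve measure of `ε'` pushes forward to that of `ε`
under the 2:1 cover: arc length `× √2`, inverse speed `× 1/√2`, two sheets).  Why it might fail: only through the `sInf` junk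
conventions (it needs `BddBelow` of the `ε'` value set) — the identity itself is exact. (the card's own OPEN statement, a hypothesis of the glue below — no cite tag) -/
def ChannelInfSublatticeLe : Prop :=
  ∀ μ ∈ Set.Ioo (-4 : ℝ) 0, ∀ U : ℝ, ∀ χ : D4Irrep,
    channelInf (squareDispersion 0 1) μ U (tauIrrep χ) ≤ channelInf (squareDispersion 1 0) μ U χ

/-- **crux K2 (rank 3) — deck-even half of the sublattice duality.** Conversely every `τχ`-state `ψ'` of `ε'` splits into its
even and odd parts under the deck shift `D : k ↦ k + (π, π)` (`ε' ∘ D = ε'`, and the kernel `U + U² χ'(k+k')` is `D`-invariant in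
EACH argument because `χ'` is `(π,π)`-periodic); the odd part is annihilated by the kernel, the even part descends to a `χ`-state
of `ε`, so `⟨ψ', K' ψ'⟩ = ‖ψ'_even‖² · (a Rayleigh quotient of ε) ≥ min (channelInf ε …, 0)`.  Why it might fail: the global,
pointwise `InChannel` condition forces a periodisation/re-projection step (`d4Project` idempotence + `σ`-a.e. equality on the
Fermi curve); wrong only if that bookkeeping hides a boundary (`[-π, π)` half-open) subtlety of positive `μH[1]`-measure. (the card's own OPEN statement, a hypothesis of the glue below — no cite tag) -/
def ChannelInfSublatticeGe : Prop :=
  ∀ μ ∈ Set.Ioo (-4 : ℝ) 0, ∀ U : ℝ, ∀ χ : D4Irrep,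
    min (channelInf (squareDispersion 1 0) μ U χ) 0 ≤ channelInf (squareDispersion 0 1) μ U (tauIrrep χ)

/-- **support S1 — the Lindhard function transports exactly**: `χ'(q) = χ(A q)` (change of variables `u = A p` in the
Brillouin-zone integral: `dp = du/2`, and `A(BZ)` covers the torus twice; integrable ↔ integrable, so the Bochner junk values
match too). (the card's own OPEN statement, a hypothesis of the glue below — no cite tag) -/
def LindhardSublattice : Prop :=
  ∀ μ : ℝ, ∀ q : Momentum,
    lindhardFunction (squareDispersion 0 1) μ q = lindhardFunction (squareDispersion 1 0) μ (sublatticeMap q)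

/-- **support S2 — the filling transports exactly**: `n'(μ) = n(μ)` (same change of variables), hence the doping ↔ chemical
potential dictionary of the two bands is identical (`chemicalPotential_sublattice_of`). (the card's own OPEN statement, a hypothesis of the glue below — no cite tag) -/
def FillingSublattice : Prop :=
  ∀ μ : ℝ, KohnLuttinger.filling (squareDispersion 0 1) μ = KohnLuttinger.filling (squareDispersion 1 0) μ

/-- **support S3 — the sign of `t'` is immaterial on `μ ∈ (-4, 0)`**: `squareDispersion 0 (-1) = -squareDispersion 0 1
= squareDispersion 0 1 ∘ (· + (π, 0))`; the translation preserves the filling and the pairing form and twists the rotations only by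
the deck shift, which the kernel does not see (all bottoms are `≤ 0` there, so the odd sector never decides).  This is the
physical far end `t/t' → 0⁻` of the scan axis `t'/t < 0`. Why it might fail: same periodisation bookkeeping as K2. (the card's own OPEN statement, a hypothesis of the glue below — no cite tag) -/
def ChannelInfNNNSign : Prop :=
  ∀ μ ∈ Set.Ioo (-4 : ℝ) 0, ∀ U : ℝ, ∀ χ : D4Irrep,
    channelInf (squareDispersion 0 (-1)) μ U χ = channelInf (squareDispersion 0 1) μ U χ

/-! ### Elementary consequences (PROVED) -/

/-- S1 ⇒ the Kohn–Luttinger kernels agree along `A × A`. [folklore] -/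
theorem kernel_sublattice_of (hS1 : LindhardSublattice) (μ U : ℝ) (k k' : Momentum) :
    kohnLuttingerKernel (squareDispersion 0 1) μ U k k' =
      kohnLuttingerKernel (squareDispersion 1 0) μ U (sublatticeMap k) (sublatticeMap k') := by
  rw [kohnLuttingerKernel, kohnLuttingerKernel, hS1, sublatticeMap_add]

/-- S2 ⇒ the two bands have the same chemical potential at every density. [folklore] -/
theorem chemicalPotential_sublattice_of (hS2 : FillingSublattice) (n : ℝ) :
    chemicalPotentialOfDensity (squareDispersion 0 1) n = chemicalPotentialOfDensity (squareDispersion 1 0) n := by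
  unfold FillingSublattice at hS2
  simp only [chemicalPotentialOfDensity, hS2]

/-- K1 + K2 + the landed `CwThesis.stub_channelInfNonpos` ⇒ the duality is an EQUALITY of channel bottoms on `μ ∈ (-4, 0)`:
`channelInf ε' μ U (τχ) = channelInf ε μ U χ`. [folklore] -/
theorem channelInf_sublattice_eq (hK1 : ChannelInfSublatticeLe) (hK2 : ChannelInfSublatticeGe)
    {μ : ℝ} (hμ : μ ∈ Set.Ioo (-4 : ℝ) 0) (U : ℝ) (χ : D4Irrep) :
    channelInf (squareDispersion 0 1) μ U (tauIrrep χ) = channelInf (squareDispersion 1 0) μ U χ := by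
  refine le_antisymm (hK1 μ hμ U χ) ?_
  have h := hK2 μ hμ U χ
  rwa [min_eq_left (CwThesis.stub_channelInfNonpos U χ hμ)] at h

/-! ### The glue: a certified positive `B1g` window is a certified NEGATIVE `B1g` window of the dual band -/

/-- The shape of the landed `t' = 0` window statement with margin `γ` (conclusion of `klb1g_window_d005_d035_const`). -/
def B1gWindowT0 (γ : ℝ) : Prop :=
  ∀ μ ∈ Set.Icc (-0.8925 : ℝ) (-0.075), ∀ U ∈ Set.Ioo (0 : ℝ) 1, ∀ χ : D4Irrep, χ ≠ D4Irrep.B1g →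
    channelInf (squareDispersion 1 0) μ U D4Irrep.B1g + γ * U ^ 2 ≤ channelInf (squareDispersion 1 0) μ U χ

/-- **The dual window**: for the pure next-nearest-neighbour band `squareDispersion 0 1` on the same `μ`-window, `B2g = d_{xy}`
leads EVERY other channel by `γ U²` — in particular the `B1g` margin `channelInf B1g - min_{χ ≠ B1g} channelInf χ` is `≤ -γ U² < 0`
(a certified FAILED `d_{x²-y²}` margin). -/
def DualWindowB2g (γ : ℝ) : Prop :=
  ∀ μ ∈ Set.Icc (-0.8925 : ℝ) (-0.075), ∀ U ∈ Set.Ioo (0 : ℝ) 1, ∀ χ : D4Irrep, χ ≠ D4Irrep.B2g →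
    channelInf (squareDispersion 0 1) μ U D4Irrep.B2g + γ * U ^ 2 ≤ channelInf (squareDispersion 0 1) μ U χ

/-- **Glue (PROVED)**: K1 + K2 + non-positivity of the `t' = 0` bottoms + a positive `B1g` window ⇒ the dual `B2g` window with the
SAME margin.  Order logic: `B2g' ≤ B1g₀` (K1 at `χ = B1g`); `B1g₀ + γU² ≤ (τχ)₀` (window at the rival `τχ ≠ B1g`);
`(τχ)₀ = min ((τχ)₀, 0) ≤ χ'` (non-positivity, then K2 at `τχ`, `τ² = 1`). [folklore] -/
theorem dualWindow_of (hK1 : ChannelInfSublatticeLe) (hK2 : ChannelInfSublatticeGe)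
    (hnonpos : ∀ μ ∈ Set.Ioo (-4 : ℝ) 0, ∀ U : ℝ, ∀ χ : D4Irrep, channelInf (squareDispersion 1 0) μ U χ ≤ 0)
    {γ : ℝ} (hwin : B1gWindowT0 γ) : DualWindowB2g γ := by
  intro μ hμ U hU χ hχ
  have hμ' : μ ∈ Set.Ioo (-4 : ℝ) 0 := ⟨by linarith [hμ.1], by linarith [hμ.2]⟩
  have h1 : channelInf (squareDispersion 0 1) μ U D4Irrep.B2g ≤ channelInf (squareDispersion 1 0) μ U D4Irrep.B1g := by
    simpa [tauIrrep] using hK1 μ hμ' U D4Irrep.B1g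
  have h2 := hwin μ hμ U hU (tauIrrep χ) (tauIrrep_ne_B1g hχ)
  have h3 : channelInf (squareDispersion 1 0) μ U (tauIrrep χ) ≤ channelInf (squareDispersion 0 1) μ U χ := by
    have h := hK2 μ hμ' U (tauIrrep χ)
    rwa [min_eq_left (hnonpos μ hμ' U (tauIrrep χ)), tauIrrep_tauIrrep] at h
  linarith

/-- **The dual cell, instantiated on the landed records** (`klb1g_window_d005_d035_const`, margin `10371/2^20 ≈ 9.89e-3`, modulo the
same twelve enclosure hypotheses that condition the positive window; `CwThesis.stub_channelInfNonpos` is a theorem): conditional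
on K1 + K2 only, `d_{xy}` leads by `γU²` for `squareDispersion 0 1` on `μ ∈ [-0.8925, -0.075]`, `U ∈ (0,1)`. [folklore] -/
theorem dualWindowB2g_d005_d035 (hK1 : ChannelInfSublatticeLe) (hK2 : ChannelInfSublatticeGe)
    (hU1 : klCertB1gWinU1.EnclosuresB1g) (hU2 : klCertB1gWinU2.EnclosuresB1g) (hU3 : klCertB1gWinU3.EnclosuresB1g)
    (hV : klCertB1gWinV.EnclosuresB1g) (hW : klCertB1gWinW.EnclosuresB1g) (hX : klCertB1gWinX.EnclosuresB1g)
    (hY : klCertB1gWinY.EnclosuresB1g) (hZ : klCertB1gWinZ.EnclosuresB1g) (hA : klCertB1gWinA.EnclosuresB1g)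
    (hB : klCertB1gWinB.EnclosuresB1g) (hC : klCertB1gWinC.EnclosuresB1g) (hD : klCertB1gWinD.EnclosuresB1g) :
    DualWindowB2g (10371 / 1048576) :=
  dualWindow_of hK1 hK2 (fun _ hμ U χ => CwThesis.stub_channelInfNonpos U χ hμ)
    (klb1g_window_d005_d035_const hU1 hU2 hU3 hV hW hX hY hZ hA hB hC hD)

/-- With S3 the same dual window holds for the physical sign `squareDispersion 0 (-1)` (`t' < 0`, the far end of the scan axis). [folklore] -/
theorem dualWindowB2g_negSign_of (hS3 : ChannelInfNNNSign) {γ : ℝ} (h : DualWindowB2g γ) :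
    ∀ μ ∈ Set.Icc (-0.8925 : ℝ) (-0.075), ∀ U ∈ Set.Ioo (0 : ℝ) 1, ∀ χ : D4Irrep, χ ≠ D4Irrep.B2g →
      channelInf (squareDispersion 0 (-1)) μ U D4Irrep.B2g + γ * U ^ 2 ≤ channelInf (squareDispersion 0 (-1)) μ U χ := by
  intro μ hμ U hU χ hχ
  have hμ' : μ ∈ Set.Ioo (-4 : ℝ) 0 := ⟨by linarith [hμ.1], by linarith [hμ.2]⟩
  rw [hS3 μ hμ' U D4Irrep.B2g, hS3 μ hμ' U χ]
  exact h μ hμ U hU χ hχ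

/-! ### HQ1 (iii) in the director's format: two certified cells of opposite sign at `δ = 1/8` -/

/-- **Ratio-axis bracket at `δ = 1/8`.** At hole doping `1/8` (chemical potential `μ(7/8)` of EACH band) and every `U ∈ (0,1)`:
at the nearest-neighbour end (`t'/t = 0`) the `B1g` margin is `≥ γU² > 0` (d_{x²-y²} leads every channel), at the
next-nearest-neighbour end (`t/t' = 0`) it is `≤ -γU² < 0` (`B1g` trails `B2g`).  So the sign of (`B1g` − best rival) differs at
the two ends of the hopping-ratio axis — a certified bracket of a sign change (NOT a located or unique crossing: the bottoms may
jump at Lifshitz points of the interpolating bands). -/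
def RatioAxisBracketD0125 (γ : ℝ) : Prop :=
  ∀ U ∈ Set.Ioo (0 : ℝ) 1,
    (∀ χ : D4Irrep, χ ≠ D4Irrep.B1g →
      channelInf (squareDispersion 1 0) (chemicalPotentialOfDensity (squareDispersion 1 0) (1 - 1 / 8)) U D4Irrep.B1g
          + γ * U ^ 2 ≤
        channelInf (squareDispersion 1 0) (chemicalPotentialOfDensity (squareDispersion 1 0) (1 - 1 / 8)) U χ) ∧
    channelInf (squareDispersion 0 1) (chemicalPotentialOfDensity (squareDispersion 0 1) (1 - 1 / 8)) U D4Irrep.B2g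
        + γ * U ^ 2 ≤
      channelInf (squareDispersion 0 1) (chemicalPotentialOfDensity (squareDispersion 0 1) (1 - 1 / 8)) U D4Irrep.B1g

/-- `μ(7/8) ∈ [-0.5725, -0.1775] ⊂ [-0.8925, -0.075]` for the `t' = 0` band — the landed, unconditional
`muOfDoping_mem_window_d010_d025` at `δ = 1/8`. [folklore] -/
theorem mu_d0125_mem_window :
    chemicalPotentialOfDensity (squareDispersion 1 0) (1 - 1 / 8) ∈ Set.Icc (-0.8925 : ℝ) (-0.075) := by
  have h := muOfDoping_mem_window_d010_d025 (1 / 8) ⟨by norm_num, by norm_num⟩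
  exact ⟨by linarith [h.1], by linarith [h.2]⟩

/-- **Glue (PROVED)**: positive window + dual window + S2 ⇒ the `δ = 1/8` bracket. [folklore] -/
theorem ratioAxisBracket_of {γ : ℝ} (hwin : B1gWindowT0 γ) (hdual : DualWindowB2g γ) (hS2 : FillingSublattice) :
    RatioAxisBracketD0125 γ := by
  intro U hU
  have hμ := mu_d0125_mem_window
  refine ⟨fun χ hχ => hwin _ hμ U hU χ hχ, ?_⟩
  rw [chemicalPotential_sublattice_of hS2]
  exact hdual _ hμ U hU D4Irrep.B1g (by decide)

/-- **The bracket on the records**: conditional on K1, K2, S2 (exact duality statements) and the twelve enclosure hypotheses of the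
landed window. [folklore] -/
theorem ratioAxisBracket_d0125_of_records (hK1 : ChannelInfSublatticeLe) (hK2 : ChannelInfSublatticeGe) (hS2 : FillingSublattice)
    (hU1 : klCertB1gWinU1.EnclosuresB1g) (hU2 : klCertB1gWinU2.EnclosuresB1g) (hU3 : klCertB1gWinU3.EnclosuresB1g)
    (hV : klCertB1gWinV.EnclosuresB1g) (hW : klCertB1gWinW.EnclosuresB1g) (hX : klCertB1gWinX.EnclosuresB1g)
    (hY : klCertB1gWinY.EnclosuresB1g) (hZ : klCertB1gWinZ.EnclosuresB1g) (hA : klCertB1gWinA.EnclosuresB1g)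
    (hB : klCertB1gWinB.EnclosuresB1g) (hC : klCertB1gWinC.EnclosuresB1g) (hD : klCertB1gWinD.EnclosuresB1g) :
    RatioAxisBracketD0125 (10371 / 1048576) :=
  ratioAxisBracket_of (klb1g_window_d005_d035_const hU1 hU2 hU3 hV hW hX hY hZ hA hB hC hD)
    (dualWindowB2g_d005_d035 hK1 hK2 hU1 hU2 hU3 hV hW hX hY hZ hA hB hC hD) hS2

end KlSublattice

end Summit.HubbardSuperconductivity.HubbardSuperconductivity.Theorems
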